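import Summits.AnomalousDissipation.AnomalousDissipation.Theorems.MomentParityResolvedDissipationStubLimitSSSShell

/-!
# `MomentParity.ResolvedDissipation` (stmt-AnomalousDissipation-14284), line `lions-l4-domination`,
# stub K2b: Galerkin limits of admissible laws are stationary statistical solutions

`stub_limitIsStationarySolution`: let `μ_i` be admissible laws (probability, carried by level-`N_i`
fields, supported in the ball `‖u‖ ≤ R`, polynomially stationary at every degree for Galerkin NS at
`(ν, f)`, `ν > 0`, `f ∈ L²`) at levels `N_i → ∞`, converging to a probability law `μ_∞` carried by
the ball in the sense of the extraction stub K2a — convergence of `∫ g` for bounded norm-continuous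
`g : H → ℝ` and the portmanteau inequality `∫ G dμ_∞ ≤ liminf ∫ G dμ_i` for lower semicontinuous
`G : H → [0, ∞]`. Then `μ_∞` is a stationary statistical solution of NS at `(ν, f)` in the tree's
sense (`Torus.IsStationaryStatisticalSolution`, Foias–Manley–Rosa–Temam 2001, Ch. IV Def. 1.3):

* (1.29) finite mean enstrophy — `u ↦ ‖∇u‖²` is lsc on `H` and the energy row gives the
  `N`-uniform budget `∫‖∇u‖² dμ_i ≤ ‖f‖₂R/ν` (helper II, `lintegral_eGradNormSq_limit_le`);
* (1.30) the Liouville identity for every cylindrical test `Φ` (`generator_limit`, this file) — at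
  level `N_i` the functional with the truncated fields `P_{N_i} gⱼ` (band tests) and the same profile
  has vanishing row (polynomial rows by stationarity, `C¹` profiles by the landed density upgrade
  `MomentParityMomentClosure.integral_nsGeneratorPairing_grad_eq_zero`); on the carrier its
  coordinates agree with those of `Φ`, and `|⟨F(u), gⱼ⟩ - ⟨F(u), P_N gⱼ⟩| → 0` uniformly on the
  ball (uniform convergence of truncations of smooth fields with derivatives, helper I); the row of
  `Φ` is norm-continuous on `H` and bounded on the ball, so it passes to the limit;
* (1.31) the shell energy inequality — the weighted energy rows `∫ p(|u|²)[(u,f) - ν‖∇u‖²] dμ_i = 0`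
  (polynomial `p`, helper I) pass to the limit as an INEQUALITY for `p ≥ 0` on `[0, R²]` (helper II),
  then Weierstrass approximation of continuous ramps and dominated convergence give the sharp shells.
-/

noncomputable section

-- `Summit.<Summit>.<Problem>`: single-conjunct summit, the duplicate namespace segment is mandated.
set_option linter.dupNamespace false

namespace Summit.AnomalousDissipation.AnomalousDissipation.Theorems.MomentParityResolvedDissipation.LimitSSS

open MeasureTheory Filter Topology
open scoped ENNReal NNReal InnerProductSpace RealInnerProductSpace
open Literature.Analysis.FunctionSpaces Literature.Analysis.FluidPDE
open Summit.AnomalousDissipation.AnomalousDissipation.Theses.MomentParity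
open Summit.AnomalousDissipation.AnomalousDissipation.Theorems.QuarticGate.Negative

/-! ## (1.30) The Liouville identity of the limit -/

/-- **(1.30) for the limit.** Along an admissible sequence at levels `N_i → ∞` converging in the
bounded-continuous sense to a law carried by the ball, the row `∫ ⟨F(u), Φ'(u)⟩ dμ_∞` of every
cylindrical test functional `Φ` vanishes (with integrable integrand): at level `N_i` the functional
with the truncated fields `P_{N_i} gⱼ` has vanishing row (band tests; polynomial rows by stationarity
and the `C¹` upgrade `MomentParityMomentClosure.integral_nsGeneratorPairing_grad_eq_zero`), its
coordinates coincide with those of `Φ` on level-`N_i` fields, and the tested generators of `gⱼ` and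
`P_{N_i} gⱼ` differ by `o(1)` uniformly on the ball; the row of `Φ` is norm-continuous and bounded
on the ball, hence passes to the limit after clamping. [folklore] -/
theorem generator_limit {ν : ℝ} {f : UnitAddTorus (Fin 3) → EuclideanSpace ℝ (Fin 3)}
    (hf : MemLp f 2 volume) {R : ℝ} (hR : 0 ≤ R) {Nl : ℕ → ℕ}
    {μ : ℕ → Measure (Torus.energySpace (Fin 3))} (hp : ∀ i, IsProbabilityMeasure (μ i))
    (hl : ∀ i, ∀ᵐ u ∂(μ i), IsLevel (Nl i) u) (hb : ∀ i, ∀ᵐ u ∂(μ i), ‖u‖ ≤ R)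
    (hs : ∀ i (d : ℕ), IsPolyStationary ν f (Nl i) d (μ i)) (hN : Tendsto Nl atTop atTop)
    {μlim : Measure (Torus.energySpace (Fin 3))} [IsProbabilityMeasure μlim]
    (hblim : ∀ᵐ u ∂μlim, ‖u‖ ≤ R)
    (hBC : ∀ g : Torus.energySpace (Fin 3) → ℝ, Continuous g → (∃ B : ℝ, ∀ u, |g u| ≤ B) →
      Tendsto (fun i => ∫ u, g u ∂(μ i)) atTop (𝓝 (∫ u, g u ∂μlim)))
    (Φ : Torus.CylindricalTest (Fin 3)) :
    Integrable (fun u => Torus.nsGeneratorPairing ν f u (Φ.grad u)) μlim ∧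
      ∫ u, Torus.nsGeneratorPairing ν f u (Φ.grad u) ∂μlim = 0 := by
  have hf1 : Integrable f volume := hf.integrable one_le_two
  -- the observable, its bound on the ball, integrability under the limit law
  set Gφ : Torus.energySpace (Fin 3) → ℝ := fun u => Torus.nsGeneratorPairing ν f u (Φ.grad u) with hGφ
  have hcont : Continuous Gφ := Torus.continuous_nsGeneratorPairing_grad ν hf1 Φ
  obtain ⟨K, hK0, hK⟩ := Torus.exists_abs_nsGeneratorPairing_grad_le ν hf Φ
  set B : ℝ := K * (1 + R ^ 2) with hB
  have hB0 : 0 ≤ B := by positivity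
  have hball : ∀ u : Torus.energySpace (Fin 3), ‖u‖ ≤ R → |Gφ u| ≤ B := fun u hu =>
    (hK u).trans (mul_le_mul_of_nonneg_left (by nlinarith [norm_nonneg u, pow_le_pow_left₀ (norm_nonneg _) hu 2]) hK0)
  have hint : Integrable Gφ μlim :=
    Integrable.mono' (integrable_const B) hcont.aestronglyMeasurable
      (hblim.mono fun u hu => by rw [Real.norm_eq_abs]; exact hball u hu)
  refine ⟨hint, ?_⟩
  -- the clamped observable passes to the limit
  set Gc : Torus.energySpace (Fin 3) → ℝ := fun u => max (-B) (min B (Gφ u)) with hGc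
  have hGc_cont : Continuous Gc := continuous_const.max (continuous_const.min hcont)
  have hGc_bd : ∀ u, |Gc u| ≤ B := fun u =>
    abs_le.2 ⟨le_max_left _ _, max_le (by linarith) (min_le_left _ _)⟩
  have hGc_eq : ∀ u : Torus.energySpace (Fin 3), ‖u‖ ≤ R → Gc u = Gφ u := fun u hu => by
    obtain ⟨h1, h2⟩ := abs_le.1 (hball u hu)
    simp only [hGc]
    rw [min_eq_right h2, max_eq_right h1]
  have hconv := hBC Gc hGc_cont ⟨B, hGc_bd⟩
  rw [integral_congr_ae (hblim.mono fun u hu => hGc_eq u hu)] at hconv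
  -- the per-field truncation errors (opaque names) and the error majorant `δ N → 0`
  obtain ⟨M, hM0, hM⟩ := Φ.exists_abs_fderiv_coords_le
  obtain ⟨ε, hε⟩ : ∃ ε : Fin Φ.m → ℕ → ℝ, ∀ j N, ε j N =
      (∑' k : {k // k ∉ Torus.freqBall (d := Fin 3) N},
          ‖UnitAddTorus.mFourierCoeff (EuclideanSpace.complexify ∘ Φ.g j) k‖) * (∫ x, ‖f x‖) +
        |ν| * ((∑' k : {k // k ∉ Torus.freqBall (d := Fin 3) N},
          ‖UnitAddTorus.mFourierCoeff (EuclideanSpace.complexify ∘ Torus.laplacian (Φ.g j)) k‖) *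
            (1 + R ^ 2)) +
        (∑ i, ∑' k : {k // k ∉ Torus.freqBall (d := Fin 3) N},
          ‖UnitAddTorus.mFourierCoeff (EuclideanSpace.complexify ∘ Torus.partialDeriv i (Φ.g j)) k‖) *
            R ^ 2 :=
    ⟨_, fun _ _ => rfl⟩
  have hε0 : ∀ j, Tendsto (ε j) atTop (𝓝 0) := fun j => by
    rw [funext (hε j)]
    exact tendsto_truncationError ν (Φ.g_smooth j) _ _ _
  have hεu : ∀ (j : Fin Φ.m) (N : ℕ) (u : Torus.energySpace (Fin 3)), ‖u‖ ≤ R →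
      |Torus.nsGeneratorPairing ν f u (Φ.g j) -
        Torus.nsGeneratorPairing ν f u (Torus.fourierTruncate N (Φ.g j))| ≤ ε j N := by
    intro j N u huR
    rw [hε]
    refine (abs_nsGeneratorPairing_sub_fourierTruncate_le ν hf1 (Φ.g_smooth j) N u).trans ?_
    have hu2 : ‖u‖ ^ 2 ≤ R ^ 2 := pow_le_pow_left₀ (norm_nonneg _) huR 2
    have he₂ : 0 ≤ ∑' k : {k // k ∉ Torus.freqBall (d := Fin 3) N},
        ‖UnitAddTorus.mFourierCoeff (EuclideanSpace.complexify ∘ Torus.laplacian (Φ.g j)) k‖ :=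
      tsum_nonneg fun _ => norm_nonneg _
    have he₃ : 0 ≤ ∑ i, ∑' k : {k // k ∉ Torus.freqBall (d := Fin 3) N},
        ‖UnitAddTorus.mFourierCoeff (EuclideanSpace.complexify ∘ Torus.partialDeriv i (Φ.g j)) k‖ :=
      Finset.sum_nonneg fun i _ => tsum_nonneg fun _ => norm_nonneg _
    exact add_le_add (add_le_add le_rfl (mul_le_mul_of_nonneg_left
      (mul_le_mul_of_nonneg_left (by linarith) he₂) (abs_nonneg ν))) (mul_le_mul_of_nonneg_left hu2 he₃)
  set δ : ℕ → ℝ := fun N => M * ∑ j, ε j N with hδ_def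
  have hδ : Tendsto δ atTop (𝓝 0) := by
    have h := (tendsto_finsetSum Finset.univ fun (j : Fin Φ.m) _ => hε0 j).const_mul M
    rw [Finset.sum_const_zero, mul_zero] at h
    exact h
  -- the level-`i` estimate `|∫ Gφ dμ_i| ≤ δ (N_i)`
  have hlevel : ∀ i, |∫ u, Gφ u ∂(μ i)| ≤ δ (Nl i) := by
    intro i
    haveI := hp i
    set N : ℕ := Nl i with hN_def
    -- the truncated test functional
    have hband : ∀ j, IsBandTest N (Torus.fourierTruncate N (Φ.g j)) := fun j =>
      Theorems.GalerkinInvariantLoud.EnergyFloor.isBandTest_fourierTruncate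
        (Φ.g_smooth j) (Φ.g_divFree j) (Φ.g_zeroMean j) N
    set Ψ : Torus.CylindricalTest (Fin 3) :=
      { m := Φ.m
        g := fun j => Torus.fourierTruncate N (Φ.g j)
        g_smooth := fun j => (hband j).1
        g_divFree := fun j => (hband j).2.1
        g_zeroMean := fun j => (hband j).2.2.1
        φ := Φ.φ
        φ_contDiff := Φ.φ_contDiff
        φ_compact := Φ.φ_compact } with hΨ_def
    have hμK : ∀ᵐ u ∂(μ i), u ∈ {u : Torus.energySpace (Fin 3) |
        Theorems.CubicParityLoud.Negative.IsLevel N u ∧ ‖u‖ ≤ R} :=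
      ((hl i).and (hb i)).mono fun u hu => hu
    -- its row vanishes: polynomial rows by stationarity, `C¹` profiles by the density upgrade
    have hΨ0 : ∫ u, Torus.nsGeneratorPairing ν f u (Ψ.grad u) ∂(μ i) = 0 :=
      MomentParityMomentClosure.integral_nsGeneratorPairing_grad_eq_zero ν hf1 hR hμK Ψ fun P =>
        (hs i (P.totalDegree + 1) Φ.m (fun j => Torus.fourierTruncate N (Φ.g j)) P hband le_rfl).2
    -- comparison with the row of `Φ` on the carrier
    have hcmp : ∀ u : Torus.energySpace (Fin 3), IsLevel N u → ‖u‖ ≤ R →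
        |Gφ u - Torus.nsGeneratorPairing ν f u (Ψ.grad u)| ≤ δ N := by
      intro u hu huR
      have hco : Ψ.coords u = Φ.coords u := by
        show WithLp.toLp 2 (fun j => Torus.pairing u.1 (Torus.fourierTruncate N (Φ.g j))) =
          WithLp.toLp 2 (fun j => Torus.pairing u.1 (Φ.g j))
        congr 1
        funext j
        exact pairing_fourierTruncate_of_isLevel hu ((Φ.g_smooth j).memLp 2)
      have h1 : Gφ u = ∑ j, fderiv ℝ Φ.φ (Φ.coords u) (EuclideanSpace.single j 1) *
          Torus.nsGeneratorPairing ν f u (Φ.g j) := Torus.nsGeneratorPairing_grad ν hf1 Φ u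
      have h2 : Torus.nsGeneratorPairing ν f u (Ψ.grad u) =
          ∑ j : Fin Φ.m, fderiv ℝ Φ.φ (Ψ.coords u) (EuclideanSpace.single j 1) *
            Torus.nsGeneratorPairing ν f u (Torus.fourierTruncate N (Φ.g j)) :=
        Torus.nsGeneratorPairing_grad ν hf1 Ψ u
      rw [hco] at h2
      rw [h1, h2, ← Finset.sum_sub_distrib]
      refine (Finset.abs_sum_le_sum_abs _ _).trans ?_
      simp only [hδ_def, Finset.mul_sum]
      refine Finset.sum_le_sum fun j _ => ?_
      rw [← mul_sub, abs_mul]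
      exact mul_le_mul (hM u j) (hεu j N u huR) (abs_nonneg _) hM0
    -- integrate
    have hK := MomentParityMomentClosure.isCompact_levelBall N hR
    have hGint : Integrable Gφ (μ i) := MomentParityMomentClosure.integrable_of_continuous_of_ae_mem hK hμK hcont
    have hΨint : Integrable (fun u => Torus.nsGeneratorPairing ν f u (Ψ.grad u)) (μ i) :=
      MomentParityMomentClosure.integrable_of_continuous_of_ae_mem hK hμK
        (Torus.continuous_nsGeneratorPairing_grad ν hf1 Ψ)
    have heq : ∫ u, Gφ u ∂(μ i) = ∫ u, (Gφ u - Torus.nsGeneratorPairing ν f u (Ψ.grad u)) ∂(μ i) := by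
      rw [integral_sub hGint hΨint, hΨ0, sub_zero]
    rw [heq, ← Real.norm_eq_abs]
    exact MomentParityMomentClosure.norm_integral_le_of_ae_norm_le
      (((hl i).and (hb i)).mono fun u hu => by
        rw [Real.norm_eq_abs]
        exact hcmp u hu.1 hu.2)
  -- conclude: `∫ Gc dμ_i = ∫ Gφ dμ_i → 0`
  have h0 : Tendsto (fun i => ∫ u, Gc u ∂(μ i)) atTop (𝓝 0) := by
    refine squeeze_zero_norm (fun i => ?_) (hδ.comp hN)
    rw [integral_congr_ae ((hb i).mono fun u hu => hGc_eq u hu), Real.norm_eq_abs]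
    exact hlevel i
  exact tendsto_nhds_unique hconv h0

/-! ## The stub -/

/-- **K2b `stub_limitIsStationarySolution`.** Let `μ_i` be admissible laws at levels `N_i → ∞` (same
`ν > 0`, `f ∈ L²`, ball `R`: probability, level-`N_i` carried, supported in `‖u‖ ≤ R`, polynomially
stationary at every degree for Galerkin NS at `(ν, f)`) converging to a probability law `μ_∞` carried
by the ball in the sense of K2a (bounded-continuous convergence and the lsc portmanteau). Then `μ_∞`
is a stationary statistical solution of NS at `(ν, f)` in the tree's sense
(`Torus.IsStationaryStatisticalSolution`, FMRT IV Def. 1.3): (1.29) by lower semicontinuity of the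
enstrophy and the `N`-uniform budget `‖f‖₂R/ν`; (1.30) by truncating the fields of a cylindrical
test to band tests, the density upgrade from polynomial to `C¹` profiles on the compact carrier, the
uniform convergence of truncations of smooth fields with derivatives, and bounded-continuous
convergence; (1.31) from the polynomially weighted energy rows at level `N_i`, passed to the limit as
inequalities for nonnegative weights (lsc of weighted enstrophies, `ν > 0`), Weierstrass
approximation of continuous ramps on `[0, R²]` and dominated convergence to the sharp shells. -/
theorem stub_limitIsStationarySolution :
    ∀ (ν : ℝ) (f : UnitAddTorus (Fin 3) → EuclideanSpace ℝ (Fin 3)) (R : ℝ), 0 < ν → MemLp f 2 volume →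
    ∀ (Nl : ℕ → ℕ) (μ : ℕ → Measure (Torus.energySpace (Fin 3))),
      (∀ i, IsProbabilityMeasure (μ i)) → (∀ i, ∀ᵐ u ∂(μ i), IsLevel (Nl i) u) →
      (∀ i, ∀ᵐ u ∂(μ i), ‖u‖ ≤ R) → (∀ i (d : ℕ), IsPolyStationary ν f (Nl i) d (μ i)) →
      Tendsto Nl atTop atTop →
    ∀ μlim : Measure (Torus.energySpace (Fin 3)), IsProbabilityMeasure μlim → (∀ᵐ u ∂μlim, ‖u‖ ≤ R) →
      (∀ g : Torus.energySpace (Fin 3) → ℝ, Continuous g → (∃ B : ℝ, ∀ u, |g u| ≤ B) →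
          Tendsto (fun i => ∫ u, g u ∂(μ i)) atTop (𝓝 (∫ u, g u ∂μlim))) →
      (∀ G : Torus.energySpace (Fin 3) → ℝ≥0∞, LowerSemicontinuous G →
          ∫⁻ u, G u ∂μlim ≤ Filter.liminf (fun i => ∫⁻ u, G u ∂(μ i)) atTop) →
      Torus.IsStationaryStatisticalSolution ν f μlim := by
  intro ν f R hν hf Nl μ hp hl hb hs hN μlim hplim hblim hBC hLSC
  haveI := hplim
  haveI : (ae μlim).NeBot := ae_neBot.2 (IsProbabilityMeasure.ne_zero μlim)
  have hR : 0 ≤ R := by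
    obtain ⟨u, hu⟩ := hblim.exists
    exact (norm_nonneg u).trans hu
  -- (1.29)
  have hbudget := lintegral_eGradNormSq_limit_le ν f R hν hf Nl μ hp hl hb hs μlim hLSC
  have hfin : ∫⁻ u, Torus.eGradNormSq (u.1 : UnitAddTorus (Fin 3) → EuclideanSpace ℝ (Fin 3)) ∂μlim ≠ ⊤ :=
    ne_top_of_le_ne_top ENNReal.coe_ne_top hbudget
  refine ⟨hplim, lt_top_iff_ne_top.2 hfin, fun Φ => generator_limit hf hR hp hl hb hs hN hblim hBC Φ,
    fun e₁ e₂ he => ?_⟩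
  -- (1.31): the integrand and its integrability
  set Z : Torus.energySpace (Fin 3) → ℝ := fun u =>
    (Torus.eGradNormSq (u.1 : UnitAddTorus (Fin 3) → EuclideanSpace ℝ (Fin 3))).toReal with hZ
  have hZint : Integrable Z μlim :=
    integrable_toReal_of_lintegral_ne_top Torus.measurable_eGradNormSq_coe.aemeasurable hfin
  have hPint : Integrable (fun u : Torus.energySpace (Fin 3) => Torus.pairing u.1 f) μlim :=
    Integrable.mono' (integrable_const (R * ‖hf.toLp f‖))
      (Torus.continuous_pairing_coe hf).aestronglyMeasurable (hblim.mono fun u hu => by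
        rw [Real.norm_eq_abs]
        exact (Torus.abs_pairing_coe_le hf u).trans (mul_le_mul_of_nonneg_right hu (norm_nonneg _)))
  have hF : Integrable (fun u => ν * Z u - Torus.pairing u.1 f) μlim := (hZint.const_mul ν).sub hPint
  -- polynomially weighted inequalities of the limit
  have hpoly : ∀ p : Polynomial ℝ, (∀ s ∈ Set.Icc (0 : ℝ) (R ^ 2), 0 ≤ p.eval s) →
      ∫ u, p.eval (max 0 (min (‖u‖ ^ 2) (R ^ 2))) * (ν * Z u - Torus.pairing u.1 f) ∂μlim ≤ 0 := by
    intro p hp0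
    set w : ℝ → ℝ := fun s => p.eval (max 0 (min s (R ^ 2))) with hw_def
    have hwc : Continuous w := p.continuous.comp (continuous_const.max (continuous_id.min continuous_const))
    have hmem : ∀ s, max 0 (min s (R ^ 2)) ∈ Set.Icc (0 : ℝ) (R ^ 2) := fun s =>
      ⟨le_max_left _ _, max_le (sq_nonneg R) (min_le_right _ _)⟩
    have hw0 : ∀ s, 0 ≤ w s := fun s => hp0 _ (hmem s)
    obtain ⟨B, hB⟩ := isCompact_Icc.exists_bound_of_continuousOn (p.continuous.continuousOn (s := Set.Icc (0 : ℝ) (R ^ 2)))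
    have hwB : ∀ s, w s ≤ B := fun s => (le_abs_self _).trans (hB _ (hmem s))
    have hweq : ∀ u : Torus.energySpace (Fin 3), ‖u‖ ≤ R → w (‖u‖ ^ 2) = p.eval (‖u‖ ^ 2) := by
      intro u hu
      have h1 : ‖u‖ ^ 2 ≤ R ^ 2 := pow_le_pow_left₀ (norm_nonneg _) hu 2
      simp only [hw_def]
      rw [min_eq_left h1, max_eq_right (sq_nonneg _)]
    have hrow : ∀ i, ∫ u, w (‖u‖ ^ 2) * (Torus.pairing u.1 f - ν * Z u) ∂(μ i) = 0 := by
      intro i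
      haveI := hp i
      rw [integral_congr_ae ((hb i).mono fun u hu => show w (‖u‖ ^ 2) * (Torus.pairing u.1 f - ν * Z u) =
        p.eval (‖u‖ ^ 2) * (Torus.pairing u.1 f - ν * Z u) by rw [hweq u hu])]
      exact integral_polynomial_mul_energyDefect_eq_zero ν f (Nl i) R (μ i) inferInstance hf (hl i) (hb i) (hs i) p
    have hineq := weightedEnergyIneq_limit hν hf hp hl hb hblim hBC hLSC hfin hwc hw0 hwB hrow
    have hwZ : Integrable (fun u => w (‖u‖ ^ 2) * Z u) μlim :=
      hZint.bdd_mul (hwc.comp (continuous_norm.pow 2)).aestronglyMeasurable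
        (ae_of_all _ fun u => by rw [Real.norm_eq_abs, abs_of_nonneg (hw0 _)]; exact hwB _)
    have hwP : Integrable (fun u => w (‖u‖ ^ 2) * Torus.pairing u.1 f) μlim :=
      hPint.bdd_mul (hwc.comp (continuous_norm.pow 2)).aestronglyMeasurable
        (ae_of_all _ fun u => by rw [Real.norm_eq_abs, abs_of_nonneg (hw0 _)]; exact hwB _)
    have hsplit : (fun u : Torus.energySpace (Fin 3) => w (‖u‖ ^ 2) * (ν * Z u - Torus.pairing u.1 f)) =
        fun u => ν * (w (‖u‖ ^ 2) * Z u) - w (‖u‖ ^ 2) * Torus.pairing u.1 f := by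
      funext u; ring
    show ∫ u, w (‖u‖ ^ 2) * (ν * Z u - Torus.pairing u.1 f) ∂μlim ≤ 0
    rw [hsplit, integral_sub (hwZ.const_mul ν) hwP, integral_const_mul]
    linarith
  -- the sharp shell
  have hT : MeasurableSet {u : Torus.energySpace (Fin 3) | e₁ ≤ ‖u‖ₑ ^ 2 ∧ ‖u‖ₑ ^ 2 < e₂} :=
    ((ENNReal.continuous_pow 2).comp continuous_enorm).measurable measurableSet_Ico
  obtain ⟨w, hwc, hw01, hwlim⟩ := exists_shellWeights he
  refine setIntegral_nonpos_of_polynomial_weights hblim hF hpoly hT w hwc hw01 fun u _ => ?_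
  have h := hwlim (‖u‖ ^ 2) (sq_nonneg _)
  have he : ‖u‖ₑ ^ 2 = ENNReal.ofReal (‖u‖ ^ 2) := by
    rw [← ofReal_norm, ENNReal.ofReal_pow (norm_nonneg _)]
  simp only [Set.indicator_apply, Set.mem_setOf_eq, Pi.one_apply, he]
  exact h

end Summit.AnomalousDissipation.AnomalousDissipation.Theorems.MomentParityResolvedDissipation.LimitSSS

end
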